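import Summits.ABC.IUTFork.Cor312VolumesLocal
import Literature.IUT.LogVolume.ArchimedeanPacketLogVolumeInvariance
import Literature.IUT.LogVolume.ArchimedeanTensorCopiesDecomposition
import Literature.LinearAlgebra.BaseChange.PiTensorRestrictScalars
import HarnessLib

/-!
# [IUTchIII] Corollary 3.12, statement — the verbatim container at the ARCHIMEDEAN place on the REAL
# archimedean tensor packets `M_I = ⊗_ℝ (⊕_{v|∞} ℂ_v)`; the (Ind1)/(Ind2) generator facts PROVED

Record-only file (D-0012) of the abc-iut cell (wave-5 prover seat abc-iut-w5-d163 gen 2; TEAM A row A-0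
«finiteness + BridgeHyps at the real setting», NAMED LEFTOVER (4) of abc-iut-c312-5's A-0 line 2026-08-26T00:39:37Z
«archimedean radial container (print-level) vs DH convention»); TAKES NO SIDE on [IUTchIII] Cor. 3.12.
`Cor312VolumesSummands`/`Cor312VolumesLocal` (abc-iut-c312-5) type the verbatim mono-analytic container of
[IUTchIII] Rmk. 3.1.1 (ii)(iii) (kurims `paper:url-4b091feeb646` pp. 94–96) as data `LocalPieces L v_ℚ` plus the
hypothesis structure `GeneratorsPreserve`; `Cor312VolumesPadicSummands` constructs the data at `v_ℚ = p`, and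
`Cor312VolumesRealAssembly` put the TRIVIAL one-point container at `v_ℚ = ∞` as a flagged modelling choice. THIS
file constructs HONEST data at `v_ℚ = ∞` from an ARCHIMEDEAN PRESENTATION of the log-shell carriers over `∞` —
each `log(𝒟^⊢_v)`, `v | ∞`, IS (as a `ℚ`-module) a copy of `ℂ` under which the log-shell is the closed ball of
radius `π` ([IUTchIII] Prop. 1.2 (vii), Rmk. 1.2.2 (ii) p. 36 "`I_k = {a ∈ k | |a| ≤ π}`") and the
strip-automorphisms resp. the order-2 automorphisms of the signature act by `ℝ`-linear ISOMETRIES of `ℂ`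
([IUTchIII] Thm. 3.11 (i) (Ind2) p. 154 l. 59–60 "copies of each of the automorphisms of order 2"; [AbsTopIII]
Prop. 5.8 (v)) — and PROVES `GeneratorsPreserve` for it:
* the summand at label `j` := abc-iut-L5-t7's REAL archimedean packet `M_I = ⊗_{i∈S^±_{j+1},ℝ} (⊕_{v|∞} ℂ_v)`
  (`Prop15iii.MI`, [IUTchIV] Prop. 1.5 (iii); ONE summand, weight `1`: the direct sum decomposition of `M_I` into
  copies of `ℂ`, [IUTchIII] Prop. 3.1 (i) / [IUTchIV] Prop. 1.5 (iii), is carried INSIDE the log-volume — L5-t7's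
  normalised packet log-volume `packetLogVol` is `(dim_ℝ)⁻¹·(log vol − log vol(B_I))` in the coordinates of a
  decomposition, i.e. the normalised-weight average of the radial log-volumes of the copies on product regions,
  [IUTchIII] Prop. 3.9 (i) archimedean case pp. 115–116, and is decomposition-INDEPENDENT, `packetLogVol_eq`);
  admissibility := positive finite Lebesgue volume in the coordinates of the canonical decomposition `Φ₀`;
  comparison `e` := campaign-S `piTensorRestrictScalars ℚ ℝ` after the presentation ([IUTchIII] Prop. 3.1 (i);
  Rmk. 3.1.1 (i) "say, over `ℚ`" → `⊗_ℝ`), SURJECTIVE;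
* (Ind2) and the strip part of (Ind1): a factor-and-summand-wise family `⊗_i ⊕_v g_{i,v}` acting by isometries
  of `ℂ` under the presentation is intertwined with L5-t7's INDUCED automorphism `induced I V τ` ([IUTchIV]
  Prop. 1.5 (iii)), which preserves every decomposition, hence volumes and log-volumes (`packetLogVol_image_induced`
  = [IUTchIV] Step (vii) p. 30 "(Ind1) and (Ind2) are taken into account by the fact that `B_I ⊆ M_I` is
  preserved") — `ism_preserves`, `strip_preserves`;
* the permutation part of (Ind1) (capsule permutation `σ`, Dupuy–Hilado §4.7) is Mathlib's re-indexing of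
  `⊗_i M`, an `ℝ`-ALGEBRA automorphism (`reindexAlgEquiv`), hence — by the uniqueness of the decomposition,
  L5-t7 `prop15iii_unique_holds` — decomposition-preserving (`preservesDecomposition_reindex`, the one new lemma);
  `perm_preserves`; assembled: `generatorsPreserve_toLocalPieces`.
Also: the log-measure of the Step (vii) container, `logμ (π^{j+1}·B_I) = (j+1)·log π` (`logμ_pi_pow_smul_ball`)
— the archimedean term the trivial container set to `0`. [claim: Mochizuki2012, status: disputed] for the quoted
container; every theorem is bookkeeping over abc-iut-L5-t7's and campaign-S's PROVED theorems (classical real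
linear algebra / Lebesgue measure). Deliberately NOT here: the presentation of a CONCRETE signature (companion
`Cor312VolumesRealArch`: c312-5's `Real.logShellsDH` under [IUTchI] Def. 3.1 (a) "`√−1 ∈ F`"), Θ-boxes, hulls,
any judgement.
-/

noncomputable section

open Set Function PiTensorProduct MeasureTheory
open scoped TensorProduct Pointwise ENNReal

namespace Summit.ABC

namespace IUTFork

namespace Cor312Vol

open Thm311 Literature.IUT.LogThetaLattice Literature.IUT.LogVolume Literature.IUT.LogVolume.Prop15iii
  Literature.IUT.LogVolume.ArchPacket Literature.LinearAlgebra.BaseChange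

variable {T : ThetaIndex}

/-- **An ARCHIMEDEAN PRESENTATION of the log-shell carriers over a place `v_ℚ`** (intended: `v_ℚ = ∞`): for
each `v | v_ℚ` a `ℚ`-linear identification `φ_v : log(𝒟^⊢_v) ≃ ℂ` ([IUTchIII] Prop. 1.2 (vii): `log(𝒟^⊢_v) =
k~(G_v)`, a copy of the complex archimedean field `K_v`; [IUTchI] Def. 3.1 (a) "`√−1 ∈ F`" makes every
archimedean `K_v` complex) under which the log-shell is the closed ball of radius `π` (Rmk. 1.2.2 (ii) p. 36
"`I_k = {a ∈ k | |a| ≤ π}`") and the strip-automorphisms resp. the order-2 automorphisms of the signature are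
`ℝ`-linear ISOMETRIES of `ℂ` (true for c312-5's `stripAutDH = {1}` and `ismDH (.inl w) = {1, −1}`; [AbsTopIII]
Prop. 5.8 (v): the archimedean indeterminacies are generated by `±1` and complex conjugation on the factors).
HYPOTHESIS/data structure; an instance over a concrete signature is the companion's job.
[claim: Mochizuki2012, status: disputed] -/
structure ArchPresentation (L : LogShells T) (vQ : T.VQ) : Type 1 where
  /-- `log(𝒟^⊢_v) ≃ ℂ` as `ℚ`-modules, `v | v_ℚ` -/
  φ : ∀ v : T.Fibre vQ, L.carrier v.1 ≃ₗ[ℚ] ℂ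
  /-- the log-shell is the closed ball of radius `π` -/
  shell_eq : ∀ v : T.Fibre vQ, φ v '' L.shell v.1 = Metric.closedBall (0 : ℂ) Real.pi
  /-- strip-automorphisms are real linear isometries of `ℂ` -/
  strip_isometry : ∀ (v : T.Fibre vQ), ∀ g ∈ L.stripAut v.1, ∃ τ : ℂ ≃ₗᵢ[ℝ] ℂ, ∀ x, φ v (g x) = τ (φ v x)
  /-- the order-2 automorphisms ("Ism" slot at `∞`) are real linear isometries of `ℂ` -/
  ism_isometry : ∀ (v : T.Fibre vQ), ∀ g ∈ L.ism v.1, ∃ τ : ℂ ≃ₗᵢ[ℝ] ℂ, ∀ x, φ v (g x) = τ (φ v x)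

namespace ArchPresentation

variable {L : LogShells T} {vQ : T.VQ} (P : ArchPresentation L vQ)

/-- The finite fibre `{v | v_ℚ}` as a `Fintype` (noncomputably, from c312-1's `Finite` instance); a local
instance so that every coordinate space `⊕_{(w,ε)} ℂ` below carries ONE `Fintype` structure. [folklore] -/
@[reducible] def fibreFintype (vQ : T.VQ) : Fintype (T.Fibre vQ) := Fintype.ofFinite _

attribute [local instance] fibreFintype

/-! ## The real archimedean packet and its verbatim container -/

/-- The REAL archimedean summand at label `j`: abc-iut-L5-t7's `M_I = ⊗_{i ∈ S^±_{j+1}, ℝ} (⊕_{v | v_ℚ} ℂ_v)`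
([IUTchIV] Prop. 1.5 (iii); [IUTchIII] Prop. 3.1 (i)). [claim: Mochizuki2012, status: disputed] -/
abbrev X (vQ : T.VQ) (j : T.Label) : Type := MI (T.Caps j) (T.Fibre vQ)

/-- The index set of the copies of `ℂ` in the canonical decomposition of `M_I` (L5-t7 `Idx`). [claim: Mochizuki2012, status: disputed] -/
abbrev J (vQ : T.VQ) (j : T.Label) : Type := Idx (T.Caps j) (T.Fibre vQ)

/-- The canonical direct sum decomposition `Φ₀ : M_I ≅ ⊕_{(w,ε)} ℂ` of [IUTchIV] Prop. 1.5 (iii) (L5-t7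
`canonicalDecomposition`). [claim: Mochizuki2012, status: disputed] -/
def Φ₀ (vQ : T.VQ) (j : T.Label) : Decomposition (T.Caps j) (T.Fibre vQ) (J vQ j) :=
  canonicalDecomposition (T.Caps j) (T.Fibre vQ)

/-- The coordinates of a region of `M_I` in the canonical decomposition. [claim: Mochizuki2012, status: disputed] -/
def coords (vQ : T.VQ) (j : T.Label) (R : Set (X vQ j)) : Set (J vQ j → ℂ) :=
  (Φ₀ vQ j : X vQ j → (J vQ j → ℂ)) '' R

/-- ADMISSIBILITY at the archimedean place: positive finite Lebesgue volume in the coordinates of the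
canonical decomposition ("compact subsets of positive measure", [IUTchIII] Rmk. 3.1.1 (iii): the property the
log-measure reads; the same modelling choice as abc-iut-c312-3's `PacketAdm` at finite primes). [folklore] -/
def adm (vQ : T.VQ) (j : T.Label) (R : Set (X vQ j)) : Prop :=
  volume (coords vQ j R) ≠ 0 ∧ volume (coords vQ j R) ≠ ∞

/-- THE LOG-MEASURE at the archimedean place: L5-t7's normalised packet log-volume `packetLogVol Φ₀`
(`(dim_ℝ M_I)⁻¹·(log vol(Φ₀ R) − log vol(B))`, `B_I ↦ 0`; [IUTchIII] Prop. 3.9 (i) archimedean case / [IUTchIV]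
Step (vii) p. 30); independent of the decomposition (L5-t7 `packetLogVol_eq`). [claim: Mochizuki2012, status: disputed] -/
def logμ (vQ : T.VQ) (j : T.Label) (R : Set (X vQ j)) : ℝ :=
  packetLogVol (Φ₀ vQ j) R

/-- An admissible region is nonempty (its volume is positive). [folklore] -/
theorem adm_nonempty (j : T.Label) (R : Set (X vQ j)) (hR : adm vQ j R) : R.Nonempty := by
  by_contra h
  rw [Set.not_nonempty_iff_eq_empty] at h
  exact hR.1 (by rw [coords, h, Set.image_empty, measure_empty])

/-- The log-measure is monotone on admissible regions. [folklore] -/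
theorem logμ_mono (j : T.Label) (R R' : Set (X vQ j)) (hR : adm vQ j R) (hR' : adm vQ j R') (h : R ⊆ R') :
    logμ vQ j R ≤ logμ vQ j R' :=
  nlogVol_mono (J vQ j) (Set.image_mono h) hR.1 hR'.2

/-- **The archimedean term of [IUTchIV] Thm. 1.10 Step (vii) is VISIBLE in this container**: the log-measure
of the Step (vii) container `π^{|S^±_{j+1}|}·B_I` is `|S^±_{j+1}|·log π = (j+1)·log π` (L5-t7
`packetLogVol_pow_smul_ball`; p. 30 "an upper bound `(j+1)·log(π)`"). [claim: Mochizuki2012, status: disputed] -/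
theorem logμ_pi_pow_smul_ball (j : T.Label) :
    logμ vQ j (Real.pi ^ Fintype.card (T.Caps j) • ball (Φ₀ vQ j)) = Fintype.card (T.Caps j) * Real.log Real.pi :=
  packetLogVol_pow_smul_ball (Φ₀ vQ j) Real.pi_pos _

/-! ## The comparison `e : 𝓘^ℚ(^{S^±_{j+1}};𝒟^⊢_∞) → M_I` -/

/-- The presentation on 1-packets: `⊕_{v|∞} log(𝒟^⊢_v) ≃ ⊕_v ℂ_v = M`. [folklore] -/
def packet1Equiv : L.Packet1 vQ ≃ₗ[ℚ] M (T.Fibre vQ) := LinearEquiv.piCongrRight P.φ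

/-- The presentation on `(j+1)`-packets: `⊗_ℚ ⊕_v log(𝒟^⊢_v) ≃ ⊗_ℚ ⊕_v ℂ_v`. [folklore] -/
def packetEquiv (j : T.Label) : L.Packet j vQ ≃ₗ[ℚ] ⨂[ℚ] _a : T.Caps j, M (T.Fibre vQ) :=
  PiTensorProduct.congr fun _ => P.packet1Equiv

/-- **The comparison map** `e : 𝓘^ℚ(^{S^±_{j+1}};𝒟^⊢_∞) → M_I` ([IUTchIII] Prop. 3.1 (i) / Rmk. 3.1.1 (i)
"say, over `ℚ`": the presentation, then campaign-S `piTensorRestrictScalars ℚ ℝ`). [claim: Mochizuki2012, status: disputed] -/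
def comparison (j : T.Label) : L.Packet j vQ →ₗ[ℚ] X vQ j :=
  piTensorRestrictScalars ℚ ℝ (fun _ : T.Caps j => M (T.Fibre vQ)) ∘ₗ (P.packetEquiv j).toLinearMap

/-- `e` on pure tensors: `e(x_0 ⊗ ⋯ ⊗ x_j) = ⊗_{ℝ, a} (φ_v(x_{a,v}))_v`. [folklore] -/
theorem comparison_tprod (j : T.Label) (x : T.Caps j → L.Packet1 vQ) :
    P.comparison j (tprod ℚ x) = tprod ℝ fun a => fun v => P.φ v (x a v) := by
  have h1 : P.packetEquiv j (tprod ℚ x) = tprod ℚ fun a => P.packet1Equiv (x a) :=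
    PiTensorProduct.congr_tprod _ _
  unfold comparison
  rw [LinearMap.comp_apply, LinearEquiv.coe_coe, h1, piTensorRestrictScalars_tprod]
  rfl

/-- **`e` is onto** (`⊗_ℚ M → ⊗_ℝ M` is surjective: campaign-S `piTensorRestrictScalars_surjective`).
[claim: Mochizuki2012, status: disputed] -/
theorem comparison_surjective (j : T.Label) :
    Function.Surjective (Cor312Vol.ArchPresentation.comparison P j) := by
  unfold comparison
  rw [LinearMap.coe_comp]
  exact (piTensorRestrictScalars_surjective ℚ ℝ _).comp (P.packetEquiv j).surjective

/-! ## The local pieces -/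

/-- **The verbatim local pieces at `v_ℚ = ∞` on the REAL archimedean packets**: one summand `M_I` per label
(weight `1`), admissibility = positive finite volume, log-measure = the normalised packet log-volume,
comparison `e`. [claim: Mochizuki2012, status: disputed] -/
def toLocalPieces : LocalPieces L vQ where
  E _ := Unit
  X j _ := X vQ j
  adm j _ := adm vQ j
  logμ j _ := logμ vQ j
  adm_nonempty j _ R hR := adm_nonempty j R hR
  logμ_mono j _ R R' hR hR' h := logμ_mono j R R' hR hR' h
  e j x _ := P.comparison j x
  e_surjective j := fun y => by
    obtain ⟨x, hx⟩ := P.comparison_surjective j (y ())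
    exact ⟨x, funext fun u => by cases u; exact hx⟩
  w _ _ := 1
  w_nonneg _ _ := zero_le_one

/-! ## (Ind2) and the strip part of (Ind1): the induced automorphisms of `M_I` -/

section Factorwise

variable {j : T.Label}

/-- L5-t7's induced automorphism `⊗_i ⊕_v τ_{i,v}` of `M_I` as a bijection (inverse: the induced
automorphism of the inverse family, `induced_symm_apply`). [claim: Mochizuki2012, status: disputed] -/
def inducedEquiv (τ : T.Caps j → T.Fibre vQ → (ℂ ≃ₗᵢ[ℝ] ℂ)) : X vQ j ≃ X vQ j where
  toFun := induced (T.Caps j) (T.Fibre vQ) τ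
  invFun := induced (T.Caps j) (T.Fibre vQ) fun i v => (τ i v).symm
  left_inv := induced_symm_apply (T.Caps j) (T.Fibre vQ) τ
  right_inv y := by
    simpa using induced_symm_apply (T.Caps j) (T.Fibre vQ) (fun i v => (τ i v).symm) y

/-- `inducedEquiv τ` is `induced τ` as a function. [folklore] -/
@[simp] theorem inducedEquiv_apply (τ : T.Caps j → T.Fibre vQ → (ℂ ≃ₗᵢ[ℝ] ℂ)) (x : X vQ j) :
    inducedEquiv τ x = induced (T.Caps j) (T.Fibre vQ) τ x := rfl

/-- **Induced automorphisms preserve admissibility** (they preserve the canonical decomposition, hence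
volumes in coordinates: L5-t7 `volume_image_image_eq_of_preservesDecomposition`; [IUTchIV] Prop. 1.5 (iii)
"the integral structure `B_I ⊆ M_I` [is] preserved"). [claim: Mochizuki2012, status: disputed] -/
theorem adm_image_induced (τ : T.Caps j → T.Fibre vQ → (ℂ ≃ₗᵢ[ℝ] ℂ)) (R : Set (X vQ j)) :
    adm vQ j (induced (T.Caps j) (T.Fibre vQ) τ '' R) ↔ adm vQ j R := by
  classical
  unfold adm coords
  rw [volume_image_image_eq_of_preservesDecomposition (Φ₀ vQ j)
    (preservesDecomposition_induced (Φ₀ vQ j) τ) R]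

/-- **Induced automorphisms preserve the log-measure** (L5-t7 `packetLogVol_image_induced`; [IUTchIV]
Step (vii) p. 30 "the indeterminacies (Ind1) and (Ind2) are taken into account by the fact that `B_I ⊆ M_I` is
preserved by arbitrary automorphisms of the type discussed in Proposition 1.5, (iii)").
[claim: Mochizuki2012, status: disputed] -/
theorem logμ_image_induced (τ : T.Caps j → T.Fibre vQ → (ℂ ≃ₗᵢ[ℝ] ℂ)) (R : Set (X vQ j)) :
    logμ vQ j (induced (T.Caps j) (T.Fibre vQ) τ '' R) = logμ vQ j R := by
  classical
  exact packetLogVol_image_induced (Φ₀ vQ j) τ R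

/-- **Factor-and-summand-wise families are intertwined with induced automorphisms**: if each `g_{i,v}` is,
under the presentation, the real linear isometry `τ_{i,v}` of `ℂ`, then
`e(⊗_i ⊕_v g_{i,v} · x) = (⊗_i ⊕_v τ_{i,v})(e(x))`, and the latter preserves the container.
[claim: Mochizuki2012, status: disputed] -/
theorem factorwise_preserves (g : T.Caps j → ∀ v : T.Fibre vQ, L.carrier v.1 ≃ₗ[ℚ] L.carrier v.1)
    (τ : T.Caps j → T.Fibre vQ → (ℂ ≃ₗᵢ[ℝ] ℂ)) (hτ : ∀ i v x, P.φ v (g i v x) = τ i v (P.φ v x)) :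
    ∃ Ψ, P.toLocalPieces.PreservesRegions j Ψ ∧
      ∀ x, P.toLocalPieces.e j (L.factorwise j vQ (fun i => L.summandwise vQ (g i)) x) =
        Ψ (P.toLocalPieces.e j x) := by
  refine ⟨Pi.map fun _ : Unit => ⇑(inducedEquiv τ), ?_, fun x => ?_⟩
  · refine LocalPieces.PreservesRegions.summandwise P.toLocalPieces (fun _ => inducedEquiv τ) ?_ ?_
    · intro _ R
      exact adm_image_induced τ R
    · intro _ R _
      exact logμ_image_induced τ R
  · funext u
    show P.comparison j (L.factorwise j vQ (fun i => L.summandwise vQ (g i)) x) =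
      induced (T.Caps j) (T.Fibre vQ) τ (P.comparison j x)
    have key : P.comparison j ∘ₗ (L.factorwise j vQ (fun i => L.summandwise vQ (g i))).toLinearMap =
        ((induced (T.Caps j) (T.Fibre vQ) τ).restrictScalars ℚ) ∘ₗ P.comparison j := by
      refine PiTensorProduct.ext (MultilinearMap.ext fun y => ?_)
      simp only [LinearMap.compMultilinearMap_apply]
      change P.comparison j (L.factorwise j vQ (fun i => L.summandwise vQ (g i)) (L.tprod j vQ y)) =
        induced (T.Caps j) (T.Fibre vQ) τ (P.comparison j (tprod ℚ y))
      rw [L.factorwise_summandwise_tprod]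
      change P.comparison j (tprod ℚ fun i => fun v => g i v (y i v)) = _
      rw [comparison_tprod, comparison_tprod, induced_tprod]
      exact congrArg _ (funext fun a => funext fun v => by rw [onSummands_apply, hτ])
    exact LinearMap.congr_fun key x

/-- **(Ind2) preserves the verbatim container** at `v_ℚ = ∞` (the order-2 automorphisms are isometries).
[claim: Mochizuki2012, status: disputed] -/
theorem ism_preserves (g : T.Caps j → ∀ v : T.Fibre vQ, L.carrier v.1 ≃ₗ[ℚ] L.carrier v.1)
    (hg : ∀ i v, g i v ∈ L.ism v.1) :
    ∃ Ψ, P.toLocalPieces.PreservesRegions j Ψ ∧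
      ∀ x, P.toLocalPieces.e j (L.factorwise j vQ (fun i => L.summandwise vQ (g i)) x) =
        Ψ (P.toLocalPieces.e j x) := by
  choose τ hτ using fun i v => P.ism_isometry v (g i v) (hg i v)
  exact P.factorwise_preserves g τ hτ

/-- **The strip part of (Ind1) preserves the verbatim container** at `v_ℚ = ∞`.
[claim: Mochizuki2012, status: disputed] -/
theorem strip_preserves (g : T.Caps j → ∀ v : T.Fibre vQ, L.carrier v.1 ≃ₗ[ℚ] L.carrier v.1)
    (hg : ∀ i v, g i v ∈ L.stripAut v.1) :
    ∃ Ψ, P.toLocalPieces.PreservesRegions j Ψ ∧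
      ∀ x, P.toLocalPieces.e j (L.factorwise j vQ (fun i => L.summandwise vQ (g i)) x) =
        Ψ (P.toLocalPieces.e j x) := by
  choose τ hτ using fun i v => P.strip_isometry v (g i v) (hg i v)
  exact P.factorwise_preserves g τ hτ

end Factorwise

/-! ## The permutation part of (Ind1): re-indexing `⊗_i M` is decomposition-preserving -/

section Perm

variable {j : T.Label}

/-- The capsule permutation `σ` of `S^±_{j+1}` acting on `M_I = ⊗_i M` (Mathlib `PiTensorProduct.reindex`;
Dupuy–Hilado §4.7 "`x_0 ⊗ ⋯ ⊗ x_j ↦ x_{σ⁻¹(0)} ⊗ ⋯ ⊗ x_{σ⁻¹(j)}`"). [claim: Mochizuki2012, status: disputed] -/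
def reindexEquiv (vQ : T.VQ) (j : T.Label) (σ : Equiv.Perm (T.Caps j)) : X vQ j ≃ₗ[ℝ] X vQ j :=
  PiTensorProduct.reindex ℝ (fun _ : T.Caps j => M (T.Fibre vQ)) σ

/-- Re-indexing on pure tensors. [folklore] -/
theorem reindexEquiv_tprod (σ : Equiv.Perm (T.Caps j)) (m : T.Caps j → M (T.Fibre vQ)) :
    reindexEquiv vQ j σ (tprod ℝ m) = tprod ℝ fun a => m (σ.symm a) :=
  PiTensorProduct.reindex_tprod σ m

/-- Re-indexing is multiplicative for the ring structure of `M_I` (on pure tensors, then by additivity).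
[folklore] -/
theorem reindexEquiv_map_mul (σ : Equiv.Perm (T.Caps j)) (x y : X vQ j) :
    reindexEquiv vQ j σ (x * y) = reindexEquiv vQ j σ x * reindexEquiv vQ j σ y := by
  induction x using PiTensorProduct.induction_on with
  | smul_tprod r f =>
    induction y using PiTensorProduct.induction_on with
    | smul_tprod r' g =>
      rw [PiTensorProduct.smul_tprod_mul_smul_tprod, map_smul, map_smul, map_smul, reindexEquiv_tprod,
        reindexEquiv_tprod, reindexEquiv_tprod, PiTensorProduct.smul_tprod_mul_smul_tprod]
      rfl
    | add a b ha hb => rw [mul_add, map_add, ha, hb, map_add, mul_add]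
  | add a b ha hb => rw [add_mul, map_add, ha, hb, map_add, add_mul]

/-- Re-indexing preserves `1 = ⊗_i 1`. [folklore] -/
theorem reindexEquiv_map_one (σ : Equiv.Perm (T.Caps j)) : reindexEquiv vQ j σ 1 = 1 := by
  rw [PiTensorProduct.one_def, reindexEquiv_tprod]
  rfl

/-- Re-indexing as an `ℝ`-ALGEBRA automorphism of `M_I`. [folklore] -/
def reindexAlgEquiv (vQ : T.VQ) (j : T.Label) (σ : Equiv.Perm (T.Caps j)) : X vQ j ≃ₐ[ℝ] X vQ j :=
  AlgEquiv.ofLinearEquiv (reindexEquiv vQ j σ) (reindexEquiv_map_one σ) (reindexEquiv_map_mul σ)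

/-- `reindexAlgEquiv` is `reindexEquiv` as a function. [folklore] -/
@[simp] theorem reindexAlgEquiv_apply (σ : Equiv.Perm (T.Caps j)) (x : X vQ j) :
    reindexAlgEquiv vQ j σ x = reindexEquiv vQ j σ x := rfl

/-- **Capsule permutations preserve the canonical decomposition** (the one new lemma): `Φ₀ ∘ σ` is another
direct sum decomposition of the ring `M_I` into copies of `ℂ`, so by the UNIQUENESS of [IUTchIV] Prop. 1.5 (iii)
(L5-t7 `prop15iii_unique_holds`) it differs from `Φ₀` by a permutation of the copies and coordinatewise `id`/conj.
[claim: Mochizuki2012, status: disputed] -/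
theorem preservesDecomposition_reindex (σ : Equiv.Perm (T.Caps j)) :
    PreservesDecomposition (Φ₀ vQ j) (reindexEquiv vQ j σ).toLinearMap := by
  classical
  obtain ⟨e, c, h⟩ := prop15iii_unique_holds (I := T.Caps j) (V := T.Fibre vQ) (J vQ j) (J vQ j)
    (Φ₀ vQ j) ((reindexAlgEquiv vQ j σ).trans (Φ₀ vQ j))
  exact ⟨e, fun k => cjLIE (c k), fun x k => by rw [cjLIE_apply]; exact h x k⟩

/-- **Capsule permutations preserve admissibility.** [claim: Mochizuki2012, status: disputed] -/
theorem adm_image_reindex (σ : Equiv.Perm (T.Caps j)) (R : Set (X vQ j)) :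
    adm vQ j (reindexEquiv vQ j σ '' R) ↔ adm vQ j R := by
  unfold adm coords
  rw [← LinearEquiv.coe_coe, volume_image_image_eq_of_preservesDecomposition (Φ₀ vQ j)
    (preservesDecomposition_reindex σ) R]

/-- **Capsule permutations preserve the log-measure.** [claim: Mochizuki2012, status: disputed] -/
theorem logμ_image_reindex (σ : Equiv.Perm (T.Caps j)) (R : Set (X vQ j)) :
    logμ vQ j (reindexEquiv vQ j σ '' R) = logμ vQ j R := by
  unfold logμ
  rw [← LinearEquiv.coe_coe]
  exact packetLogVol_image_eq_of_preservesDecomposition (Φ₀ vQ j) (preservesDecomposition_reindex σ) R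

/-- **The permutation part of (Ind1) preserves the verbatim container** at `v_ℚ = ∞`: `e(σ · x) = σ(e(x))`
and re-indexing preserves admissibility and log-measure. [cite: DupuyHilado2025, §4.7] -/
theorem perm_preserves (σ : Equiv.Perm (T.Caps j)) :
    ∃ Ψ, P.toLocalPieces.PreservesRegions j Ψ ∧
      ∀ x, P.toLocalPieces.e j (L.permute j vQ σ x) = Ψ (P.toLocalPieces.e j x) := by
  refine ⟨Pi.map fun _ : Unit => ⇑(reindexEquiv vQ j σ).toEquiv, ?_, fun x => ?_⟩
  · refine LocalPieces.PreservesRegions.summandwise P.toLocalPieces (fun _ => (reindexEquiv vQ j σ).toEquiv)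
      ?_ ?_
    · intro _ R
      exact adm_image_reindex σ R
    · intro _ R _
      exact logμ_image_reindex σ R
  · funext u
    show P.comparison j (L.permute j vQ σ x) = reindexEquiv vQ j σ (P.comparison j x)
    have key : P.comparison j ∘ₗ (L.permute j vQ σ).toLinearMap =
        ((reindexEquiv vQ j σ).toLinearMap.restrictScalars ℚ) ∘ₗ P.comparison j := by
      refine PiTensorProduct.ext (MultilinearMap.ext fun y => ?_)
      simp only [LinearMap.compMultilinearMap_apply]
      change P.comparison j (L.permute j vQ σ (L.tprod j vQ y)) = reindexEquiv vQ j σ (P.comparison j (tprod ℚ y))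
      rw [L.permute_tprod]
      change P.comparison j (tprod ℚ fun i => y (σ.symm i)) = _
      rw [comparison_tprod, comparison_tprod, reindexEquiv_tprod]
    exact LinearMap.congr_fun key x

end Perm

/-! ## The generator hypotheses, proved -/

/-- **`GeneratorsPreserve` for the REAL archimedean packets**: at `v_ℚ = ∞`, every capsule permutation, every
factor-and-summand-wise family of strip-automorphisms and every such family of order-2 automorphisms is
intertwined by the comparison with a map preserving the verbatim container (positive-finite-volume regions,
normalised packet log-volume). Hence (`generatorsPreserve_ofLocal`, `adm_and_logvol_eq_of_mem_indGroup`,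
`Cor312VolumesSummandsBridge`) along the whole indeterminacy subgroup admissible regions keep their log-volume
at the archimedean place as well. [claim: Mochizuki2012, status: disputed] -/
theorem generatorsPreserve_toLocalPieces :
    Cor312Vol.LocalPieces.GeneratorsPreserve (Cor312Vol.ArchPresentation.toLocalPieces P) :=
  ⟨fun _ σ => P.perm_preserves σ, fun _ g hg => P.strip_preserves g hg, fun _ g hg => P.ism_preserves g hg⟩

end ArchPresentation

end Cor312Vol

end IUTFork

end Summit.ABC

end
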